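import Literature.AnabelianGeometry.EtaleTheta.TemperedFrobenioidOfThetaTwistTowerSmallIndex
import Literature.AnabelianGeometry.EtaleTheta.Discharge.Sec3Prop34iNodePrinted
import HarnessLib

/-!
# [EtTh] Def. 3.3 (iii): a centrally-acting `g ∈ Π` yields a NATURAL AUTOMORPHISM of `Φ₀ = Hom_Π(−, Div⁺(Z_∞))` over the identity
# of `D₀` — and at the ε-free theta tower `towerC₃sf` / `dmSmall` every translation `γ(g) ≠ 0` MOVES primes (proof-only)

S. Mochizuki, *The étale theta function and its Frobenioid-theoretic manifestations* [EtTh], Publ. RIMS **45** (2009) (refereed),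
Def. 3.3 (iii) pp.299–300 (PDF pp.73–74) («`Φ₀(Y^log) := lim_{→ Z^log_∞} Div⁺(Z^log_∞)^{Gal(Z^log_∞/Y^log)}` … the superscript Galois
groups denote the submonoids of elements fixed by the Galois group in question»), Rmk. 3.3.1 pp.299–300 (PDF pp.73–74) («the set of primes
… of the monoid `Div⁺(Z^log_∞)^{Gal(Z^log_∞/Y^log)}` appearing in the definition of `Φ₀(Y^log)` is in natural bijective correspondence with
the set of `Gal(Z^log_∞/Y^log)`-orbits of prime log-divisors on `Z^log_∞`»), Def. 3.6 (i)(ii) pp.302–303 (PDF pp.76–77) (bib key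
`MochizukiEtTh2009`; own render `paper:doi-10-2977-prims-1234361159` p0073/p0074; page convention printed N = PDF M + 226).

PROOF-ONLY rider (0 `def`, 0 `instance`, 0 notation, no new `Prop`; cell abc-iut, block F, seat abc-iut-f-193 gen 15; abc-iut-L2-lead
R1453 «(o-Φ)», ITEM 5 evidence of record for the «COR53IV» refutability flag R1444 (d); every input BY NAME, nothing restated).
abc-iut-w6-d058's `LogDivisorModel.GaloisAction.phiZero S = {φ : S → DIV(Z_∞) | effective Cartier values, φ(g·s) = g·φ(s)}` indexes
the Def. 3.3 (iii) monoid by the POINTS of the `Π`-set `S`; abc-iut-L2-t3's `DivisorMonoids.ofTower T` reads a connected tempered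
covering `Y` at the level of its `Δ^fil`-closure.  THIS FILE records the elementary mechanism behind ITEM 5:
* §A (any `Z`, `G`, `A : Z.GaloisAction G`, any `G`-set `S`) — for `φ ∈ Φ₀(S)` the left translate `s ↦ φ(g·s)` IS `actDIV g ∘ φ`
  (`phiZero_comp_ρ_eq`); if `actDIV g` commutes with every `actDIV h` then `actDIV g ∘ φ ∈ Φ₀(S)` (`actDIV_comp_mem_phiZero`),
  effective Cartier values by abc-iut-w6-d057's `actDIV_mem_Divplus`; inverse `actDIV g⁻¹ ∘ −`; natural under pull-back (`phiZeroPull_actDIV_comp`, `rfl`);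
* §B (any `LogDivisorTower T`) — natural under the level transitions (`transPhi_actDIV_comp`, `ofTower_Φ₀_map_actDIV_comp` ⟸ `resDIV_act`):
  a natural automorphism of `(DivisorMonoids.ofTower T).Φ₀` over the identity of `D₀ = B^temp(Π)⁰`;
* §C (abc-iut-L2-t3's ε-free theta tower `towerC₃sf` over «GRP₃′»'s compatible group `Compat₃′ ≅ Ẑ(1)³ ⋊ (Ẑˣ × ℤ_γ)`, hence
  `dmSmall = (ofTower towerC₃sf).precomp toConn`) — `towerC₃sf_actDIV` (`rfl`): at EVERY level `actDIV g = TateTowerTheta.baseAction.actDIV γ(g)`,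
  the SHIFT of cusps/components by the abelian character `γ(g) = g.right.2 ∈ ℤ_γ`; so the hypothesis of §A/§B holds for EVERY
  `g ∈ Compat₃′` (`towerC₃sf_actDIV_comm`), and the translation by `1` (`transl_mem_compat`) moves the effective Cartier prime `F_0`
  at every level (`exists_compat_actDIV_ne`) — θ_g := `actDIV g ∘ −` is a natural automorphism of `dmSmall.Φ₀` over id PERMUTING primes.
WHAT IS NOT CLAIMED (abc-iut-f-193's B₀ FLAG, abc-iut-L2-t12's W0): the same translation on `B₀ = Hom_Π(−, Mero)` is NOT an
endomorphism in general (`actFn` is the non-abelian «GRP₃′» action); nothing here about `B₀`, about a self-equivalence of a model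
Frobenioid, or about [EtTh] Def. 3.6 / [IUTchI] Cor. 5.3 in print.  HONEST FRAMING: class-(b) DESIGN tower (abc-iut-L2-t3's label),
not the tempered tower of a Tate curve; refutable-as-typed-at-a-design-carrier ≠ refuted in print; no side is taken on [IUTchIII]
Cor. 3.12; typed ≠ proved; nothing here bears on abc itself.
-/

noncomputable section

namespace Literature.AnabelianGeometry.EtaleTheta

open CategoryTheory Opposite Function Literature.AlgebraicGeometry.Frobenioids Literature.AnabelianGeometry.SemiGraphs

universe u

/-! ## §A  Post-composition by a centrally-acting `g` on `Φ₀(S) = Hom_G(S, Div⁺(Z_∞))` -/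

namespace LogDivisorModel.GaloisAction

variable {Z : LogDivisorModel.{u}} {G : Type u} [Group G] (A : Z.GaloisAction G) (S : Action (Type u) G)

/-- An element of `Φ₀(S)` is `G`-equivariant: `φ(g·s) = g·φ(s)`. [cite: MochizukiEtTh2009, Def 3.3 (iii) p.299 (PDF p.73)] -/
theorem phiZero_apply_ρ (φ : A.phiZero S) (g : G) (s : S.V) : φ.1 (S.ρ g s) = A.actDIV g (φ.1 s) := φ.2.2 g s

/-- **Left translation of the points = post-composition by `actDIV g`** on `Φ₀(S)`. [cite: MochizukiEtTh2009, Def 3.3 (iii) p.299 (PDF p.73)] -/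
theorem phiZero_comp_ρ_eq (φ : A.phiZero S) (g : G) : (fun s => φ.1 (S.ρ g s)) = fun s => A.actDIV g (φ.1 s) :=
  funext fun s => A.phiZero_apply_ρ S φ g s

/-- **If `actDIV g` commutes with every `actDIV h`, post-composition by `actDIV g` maps `Φ₀(S)` into itself** (equivariance kept).
[cite: MochizukiEtTh2009, Def 3.3 (iii) p.299 (PDF p.73)] -/
theorem actDIV_comp_mem_phiZero {g : G} (hg : ∀ (h : G) (d : Z.DIV), A.actDIV g (A.actDIV h d) = A.actDIV h (A.actDIV g d))
    (φ : A.phiZero S) : (fun s => A.actDIV g (φ.1 s)) ∈ A.phiZero S :=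
  ⟨fun s => A.actDIV_mem_Divplus g (φ.2.1 s), fun h s => by simp only [phiZero_apply_ρ, hg]⟩

/-- Post-composition by `actDIV g⁻¹` undoes post-composition by `actDIV g`. [cite: MochizukiEtTh2009, Def 3.3 (iii) p.299 (PDF p.73)] -/
theorem actDIV_inv_comp_actDIV_comp (g : G) (φ : S.V → Z.DIV) : (fun s => A.actDIV g⁻¹ (A.actDIV g (φ s))) = φ := by
  funext s
  rw [← MulAut.mul_apply, ← map_mul, inv_mul_cancel, map_one, MulAut.one_apply]

/-- Naturality under pull-back along a map of `G`-sets `S → S′` (`Φ₀` is contravariant). [cite: MochizukiEtTh2009, Def 3.3 (iii) p.299 (PDF p.73)] -/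
theorem phiZeroPull_actDIV_comp {S' : Action (Type u) G} (f : S ⟶ S') {g : G}
    (hg : ∀ (h : G) (d : Z.DIV), A.actDIV g (A.actDIV h d) = A.actDIV h (A.actDIV g d)) (φ : A.phiZero S') :
    (A.phiZeroPull f ⟨_, A.actDIV_comp_mem_phiZero S' hg φ⟩).1 = fun s => A.actDIV g ((A.phiZeroPull f φ).1 s) := rfl

end LogDivisorModel.GaloisAction

/-! ## §B  In a tower: compatibility with the level transitions (`resDIV_act`) -/

namespace LogDivisorTower

variable {P : Type u} [Group P] [TopologicalSpace P] {L : LevelSystem P} (T : LogDivisorTower P L)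

/-- Naturality under the level change `transPhi`. [cite: MochizukiEtTh2009, Def 3.3 (iii) p.300 (PDF p.74)] -/
theorem transPhi_actDIV_comp {i j : L.I} (h : L.closure j ≤ L.closure i) (S : Action (Type u) P) {g : P}
    (hg : ∀ (h' : P) (d : (T.Z i).DIV), (T.act i).actDIV g ((T.act i).actDIV h' d) = (T.act i).actDIV h' ((T.act i).actDIV g d))
    (φ : (T.act i).phiZero S) :
    (T.transPhi h S ⟨_, (T.act i).actDIV_comp_mem_phiZero S hg φ⟩).1 = fun s => (T.act j).actDIV g ((T.transPhi h S φ).1 s) :=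
  funext fun s => by simp only [transPhi_apply]; exact T.resDIV_act h g _

/-- **Naturality under `(DivisorMonoids.ofTower T).Φ₀.map`** (pull-back, then level change): post-composition by a centrally-acting `g` is a
natural transformation of `Φ₀` over the identity of `D₀ = B^temp(Π)⁰`. [cite: MochizukiEtTh2009, Def 3.3 (iii) p.300 (PDF p.74)] -/
theorem ofTower_Φ₀_map_actDIV_comp {Y Y' : (ConnectedPart (BTemp P))ᵒᵖ} (f : Y ⟶ Y') {g : P}
    (hg : ∀ (i : L.I) (h' : P) (d : (T.Z i).DIV), (T.act i).actDIV g ((T.act i).actDIV h' d) = (T.act i).actDIV h' ((T.act i).actDIV g d))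
    (φ : (T.act (L.lvl Y.unop)).phiZero (gset Y.unop)) :
    (((DivisorMonoids.ofTower T).Φ₀.map f).hom ⟨_, (T.act _).actDIV_comp_mem_phiZero _ (hg _) φ⟩).1 =
      fun s => (T.act (L.lvl Y'.unop)).actDIV g ((((DivisorMonoids.ofTower T).Φ₀.map f).hom φ).1 s) :=
  funext fun s => by
    change T.resDIV _ ((T.act _).actDIV g (φ.1 _)) = (T.act _).actDIV g (T.resDIV _ (φ.1 _))
    exact T.resDIV_act _ g _

end LogDivisorTower

/-! ## §C  The instance `towerC₃sf` / `dmSmall`: `actDIV` is the shift by the abelian character `γ` -/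

namespace LogDivisorModel.TateTowerThetaTwist

open TateTowerKummerTwistRShear (Grp thetaShear Compat compat transl_mem_compat)

/-- **At every level of `towerC₃sf`, `actDIV g` is the shift by `γ(g) = g.right.2`** (cusps `(j, ±) ↦ (j + γ, ±)`, components
`F_j ↦ F_{j+γ}`). [cite: MochizukiEtTh2009, Rmk 3.3.1 p.299 (PDF p.73)] -/
theorem towerC₃sf_actDIV (n : ℕ) (g : Compat 3 thetaShear) :
    (towerC₃sf.act n).actDIV g = TateTowerTheta.baseAction.actDIV (g : Grp 3 thetaShear).right.2 := rfl

/-- **The actions of any two `g, h ∈ Compat₃′` on log-divisors COMMUTE** (they factor through the abelian `ℤ_γ`).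
[cite: MochizukiEtTh2009, Rmk 3.3.1 p.299 (PDF p.73)] -/
theorem towerC₃sf_actDIV_comm (n : ℕ) (g h : Compat 3 thetaShear) (d : (towerC₃sf.Z n).DIV) :
    (towerC₃sf.act n).actDIV g ((towerC₃sf.act n).actDIV h d) = (towerC₃sf.act n).actDIV h ((towerC₃sf.act n).actDIV g d) := by
  change (TateTowerTheta.baseAction.actDIV (g : Grp 3 thetaShear).right.2 * TateTowerTheta.baseAction.actDIV (h : Grp 3 thetaShear).right.2) d =
    (TateTowerTheta.baseAction.actDIV (h : Grp 3 thetaShear).right.2 * TateTowerTheta.baseAction.actDIV (g : Grp 3 thetaShear).right.2) d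
  rw [← map_mul, ← map_mul, mul_comm]

/-- `actDIV g d` read on a prime log-divisor `x`: the multiplicity of `d` at `x − γ(g)`. [cite: MochizukiEtTh2009, Rmk 3.3.1 p.299 (PDF p.73)] -/
theorem toAdd_towerC₃sf_actDIV (n : ℕ) (g : Compat 3 thetaShear) (d : (towerC₃sf.Z n).DIV) (x : TateTowerTheta.Idx) :
    Multiplicative.toAdd ((towerC₃sf.act n).actDIV g d) x =
      Multiplicative.toAdd d ((TateTowerTheta.shiftIdx (Multiplicative.toAdd (g : Grp 3 thetaShear).right.2)).symm x) :=
  TateTowerTheta.toAdd_shiftDIV _ _ _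

/-- **The translation by `1` is compatible and MOVES the effective Cartier prime `F_0` (to `F_1`) at every level** — so
`θ_g := actDIV g ∘ −` is a non-trivial natural automorphism of `dmSmall.Φ₀` permuting primes. [cite: MochizukiEtTh2009, Rmk 3.3.1 p.299 (PDF p.73)] -/
theorem exists_compat_actDIV_ne (n : ℕ) :
    ∃ g : Compat 3 thetaShear, ∃ d ∈ (towerC₃sf.Z n).Divplus, (towerC₃sf.act n).actDIV g d ≠ d := by
  refine ⟨⟨SemidirectProduct.inr (1, Multiplicative.ofAdd (1 : ℤ)), transl_mem_compat 3 thetaShear _⟩,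
    Multiplicative.ofAdd (fun x => Sum.elim (fun _ => (0 : ℤ)) (fun j => if j = 0 then 1 else 0) x), ?_, ?_⟩
  · refine Submonoid.mem_inf.mpr ⟨trivial, (TateTowerTheta.ofAdd_mem_effective_iff _).2 fun x => ?_⟩
    rcases x with c | j
    · simp
    · simp only [Sum.elim_inr]; split_ifs <;> simp
  · intro h
    have h1 := congrArg (fun d : Multiplicative (TateTowerTheta.Idx → ℤ) => Multiplicative.toAdd d (Sum.inr (1 : ℤ))) h
    have h2 : Multiplicative.toAdd ((towerC₃sf.act n).actDIV
        ⟨SemidirectProduct.inr (1, Multiplicative.ofAdd (1 : ℤ)), transl_mem_compat 3 thetaShear _⟩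
        (Multiplicative.ofAdd (fun x => Sum.elim (fun _ => (0 : ℤ)) (fun j => if j = 0 then 1 else 0) x))) (Sum.inr 1) = 1 := by
      rw [toAdd_towerC₃sf_actDIV]
      change Sum.elim (fun _ => (0 : ℤ)) (fun j => if j = 0 then (1 : ℤ) else 0)
        ((TateTowerTheta.shiftIdx (Multiplicative.toAdd (Multiplicative.ofAdd (1 : ℤ)))).symm (Sum.inr 1)) = 1
      rw [toAdd_ofAdd, TateTowerTheta.shiftIdx_symm_inr, sub_self, Sum.elim_inr, if_pos rfl]
    have h3 : Multiplicative.toAdd (Multiplicative.ofAdd (fun x : TateTowerTheta.Idx =>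
        Sum.elim (fun _ => (0 : ℤ)) (fun j => if j = 0 then 1 else 0) x)) (Sum.inr (1 : ℤ)) = 0 := by
      rw [toAdd_ofAdd, Sum.elim_inr, if_neg one_ne_zero]
    exact one_ne_zero (h2.symm.trans (h1.trans h3))

end LogDivisorModel.TateTowerThetaTwist

end Literature.AnabelianGeometry.EtaleTheta

end
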